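import Mathlib
import HarnessLib
import Summits.NavierStokesRegularity.NavierStokesRegularity.Theorems.UnthreadedRigidityDoorUnthreadedRigidityHornPressureWindowWedge
import Summits.NavierStokesRegularity.NavierStokesRegularity.Theorems.UnthreadedRigidityDoorUnthreadedRigidityVirialHornIsoOrderOneLaw
import Summits.NavierStokesRegularity.NavierStokesRegularity.Theorems.UnthreadedRigidityDoorUnthreadedRigidityVirialHornAngularTwo
import Summits.NavierStokesRegularity.NavierStokesRegularity.Theorems.UnthreadedRigidityDoorUnthreadedRigidityThreadingJetsSlice
import Summits.NavierStokesRegularity.NavierStokesRegularity.Theorems.UnthreadedRigidityDoorUnthreadedRigidityHornPressureBracket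

/-!
# Route `UnthreadedRigidityDoor`, item `UnthreadedRigidity` (W2, stmt-NavierStokesRegularity-27585) — LINE g10-1 «PRESSURE HORN»:
# BRIDGE DP2 BY NAME `isotypicOrderOneIdentity_holds` («ORDER ONE IS THE WRONSKIAN») and RUNG I1 `isotypicOrderOneRigidity_holds`

Prover file (W2 Lean hand ns-crc-p2 g11, by lineage; `--supports stmt-NavierStokesRegularity-27585`, helper; 0 kit).  K2-p2 g13's PRESSURE HORN
line typed its order-one bridge DP2 `PressureHorn.IsotypicOrderOneIdentity` (M–L; «exact slice algebra kit j321686 + locality of the first jet»):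
for the classical solution on `[t₀,T)` issuing from an admissible `l = 2`-isotypic datum `isoShell Q x₀` the one-sided first threading jet at
`x₀ + r·y` (`|y| = 1`, `r > 0`) is `−24 r⁻³ · d/dr(r⁶ det[y, Q(r)y, Q′(r)y])`.  Both parts are in the tree once the isotypic degree-two dictionary
(`…HornPressureWindowWedge`, p730985) is available:

* M-part = g8's `ThreadingJets.derivWithin_threadingFlux_Ici_eq_fluxJetOne` (one-sided first jet of a classical solution = formal first jet);
* L-part = ns-crc-p2 g8's (F1) ISOTYPIC ORDER-ONE LAW `VirialHorn.fluxJetOne_isoShellL_eq` at `l = 2`, `n = 5` (coordinate profiles against the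
  basis quadratics), read back through the WEDGE CALCULUS of this file: `pbr_quadY_quadY` (`{Y_A, Y_B}(z) = 4·det[z, Az, Bz]`), bilinearity /
  antisymmetry of `wedgeDet` (`wedgeDet_add_right`, `wedgeDet_smul_right`, `wedgeDet_swap`, `wedgeDet_sum_smul_sum_smul`), and the radial
  derivative `hasDerivAt_wedge` (`d/dr det[y, Q(r)y, Q′(r)y] = det[y, Q(r)y, Q″(r)y]`, the `det[y, Q′y, Q′y]` term dying by antisymmetry), so that
  `6 · Σ K₂[c_m] c_{m′} {Y_{E_m}, Y_{E_{m′}}}(r y) = −24 r³ det[y, Q(r)y, (Q″ + 6Q′/r)(r) y] = −24 r⁻³ (r⁶ det[y, Qy, Q′y])′`.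

BY NAME: ★★ `isotypicOrderOneIdentity_holds : PressureHorn.IsotypicOrderOneIdentity` (BRIDGE DP2) and, with K2-p2's S-E `eulerVanishing_holds`,
★★ `isotypicOrderOneRigidity_holds : PressureHorn.IsotypicOrderOneRigidity` (RUNG I1: a vanishing first one-sided jet forces the admissible isotypic
datum to be PIECEWISE SEPARABLE, `Q ∧ Q′ ≡ 0`) — the composition `PressureHorn.isotypicOrderOneRigidity_of_identity` re-proved here without the
theses-cone import; and the bookkeeping corollary `isotypicOrderTwoRigidity_of_exclusion : NestedHornExclusion → IsotypicOrderTwoRigidity` (the SLICE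
RUNG I2 now waits on the crux X ALONE — DP2, S-E and ns-crc-p1 g9's separable rung `separableShellOrderTwoRigidity_holds` struck).  After this file the
PRESSURE HORN line's open decls are the crux X `NestedHornExclusion` (finite towers T: paper TOWER THEOREM) and the slice rung I2 = X's corollary.

HONEST LABEL: explicit-field calculus and `3 × 3` linear algebra about SPECIAL (isotypic `l = 2`) slices of classical solutions — a bridge and a rung
of one line on the wall item, two levels below the door; `UnthreadedRigidity` ⟨27585⟩, W2 and NS regularity remain OPEN; no summit statement is
proved here.  [cite: MajdaBertozziCUP2002, §1.1 (vector identities), §2.1 (Lamb form)]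
-/

-- the summit and its single sub-problem share the name (CONVENTIONS §1), as in every Theorems file
set_option linter.dupNamespace false

noncomputable section

namespace Summit.NavierStokesRegularity.NavierStokesRegularity.Theorems.UnthreadedRigidity.HornPressure

open scoped Topology
open Filter Set
open Literature.Analysis.FluidPDE
open Summit.NavierStokesRegularity.NavierStokesRegularity.Theorems.UnthreadedRigidity.ProfileHorn (E3 threadingFlux IsQuadForm quadY HornAdmissible)
open Summit.NavierStokesRegularity.NavierStokesRegularity.Theorems.UnthreadedRigidity.VirialHorn
  (det3 pbr IsSolidHarmonic VirialAdmissible isoShellL IsoAdmissibleL vortAmpL gradient_quadY fluxJetOne_isoShellL_eq)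
open Summit.NavierStokesRegularity.NavierStokesRegularity.Theorems.UnthreadedRigidity.ThreadingJets (fluxJetOne derivWithin_threadingFlux_Ici_eq_fluxJetOne)
open Summit.NavierStokesRegularity.NavierStokesRegularity.Theorems.UnthreadedRigidity.PressureHorn
  (isoShell radDeriv IsoAdmissible wedgeDet WedgeVanishes IsotypicOrderOneIdentity IsotypicOrderOneRigidity NestedHornExclusion
   IsotypicOrderTwoRigidity wedgeDet_eq wedgeDet_zero_left wedgeDet_smul_smul wedgeDet_smul_arg eulerVanishing_holds)

/-! ## Wedge calculus: `det[y, Ay, By]` is bilinear and antisymmetric in `(A, B)` -/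

/-- antisymmetry: `det[y, Ay, By] = −det[y, By, Ay]`. -/
theorem wedgeDet_swap (A B : Matrix (Fin 3) (Fin 3) ℝ) (y : E3) : wedgeDet A B y = -wedgeDet B A y := by
  rw [wedgeDet_eq, wedgeDet_eq]
  ring

/-- `det[y, Ay, Ay] = 0`. -/
theorem wedgeDet_self (A : Matrix (Fin 3) (Fin 3) ℝ) (y : E3) : wedgeDet A A y = 0 := by
  have h := wedgeDet_swap A A y
  linarith

/-- additivity in the third row. -/
theorem wedgeDet_add_right (A B C : Matrix (Fin 3) (Fin 3) ℝ) (y : E3) : wedgeDet A (B + C) y = wedgeDet A B y + wedgeDet A C y := by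
  rw [wedgeDet_eq, wedgeDet_eq, wedgeDet_eq, Matrix.add_mulVec]
  simp only [Pi.add_apply]
  ring

/-- homogeneity in the third row. -/
theorem wedgeDet_smul_right (A B : Matrix (Fin 3) (Fin 3) ℝ) (c : ℝ) (y : E3) : wedgeDet A (c • B) y = c * wedgeDet A B y := by
  rw [wedgeDet_eq, wedgeDet_eq, Matrix.smul_mulVec]
  simp only [Pi.smul_apply, smul_eq_mul]
  ring

/-- `det[y, Ay, 0] = 0`. -/
theorem wedgeDet_zero_right (A : Matrix (Fin 3) (Fin 3) ℝ) (y : E3) : wedgeDet A 0 y = 0 := by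
  rw [wedgeDet_swap, wedgeDet_zero_left, neg_zero]

/-- finite additivity in the third row. -/
theorem wedgeDet_sum_right {ι : Type*} (A : Matrix (Fin 3) (Fin 3) ℝ) (s : Finset ι) (F : ι → Matrix (Fin 3) (Fin 3) ℝ) (y : E3) :
    wedgeDet A (∑ i ∈ s, F i) y = ∑ i ∈ s, wedgeDet A (F i) y := by
  classical
  induction s using Finset.induction_on with
  | empty => simp [wedgeDet_zero_right]
  | insert a s ha ih => rw [Finset.sum_insert ha, Finset.sum_insert ha, wedgeDet_add_right, ih]

/-- finite additivity in the second row. -/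
theorem wedgeDet_sum_left {ι : Type*} (B : Matrix (Fin 3) (Fin 3) ℝ) (s : Finset ι) (F : ι → Matrix (Fin 3) (Fin 3) ℝ) (y : E3) :
    wedgeDet (∑ i ∈ s, F i) B y = ∑ i ∈ s, wedgeDet (F i) B y := by
  rw [wedgeDet_swap, wedgeDet_sum_right, ← Finset.sum_neg_distrib]
  exact Finset.sum_congr rfl fun i _ => by rw [wedgeDet_swap B (F i), neg_neg]

/-- homogeneity in the second row. -/
theorem wedgeDet_smul_left (c : ℝ) (A B : Matrix (Fin 3) (Fin 3) ℝ) (y : E3) : wedgeDet (c • A) B y = c * wedgeDet A B y := by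
  rw [wedgeDet_swap, wedgeDet_smul_right, wedgeDet_swap B A]
  ring

/-- the wedge of two combinations of the basis forms, expanded. -/
theorem wedgeDet_sum_smul_sum_smul (a b : Fin 5 → ℝ) (y : E3) :
    wedgeDet (∑ m : Fin 5, a m • basisV2 m) (∑ m : Fin 5, b m • basisV2 m) y =
      ∑ m : Fin 5, ∑ m' : Fin 5, a m * b m' * wedgeDet (basisV2 m) (basisV2 m') y := by
  rw [wedgeDet_sum_left]
  refine Finset.sum_congr rfl fun m _ => ?_
  rw [wedgeDet_smul_left, wedgeDet_sum_right, Finset.mul_sum]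
  refine Finset.sum_congr rfl fun m' _ => ?_
  rw [wedgeDet_smul_right]
  ring

/-- THE BRACKET OF TWO QUADRATICS IS FOUR TIMES THE WEDGE: `{Y_A, Y_B}(z) = det[z, 2Az, 2Bz] = 4·det[z, Az, Bz]` (symmetric `A`, `B`). -/
theorem pbr_quadY_quadY {A B : Matrix (Fin 3) (Fin 3) ℝ} (hA : A.IsSymm) (hB : B.IsSymm) (z : E3) :
    pbr (quadY A) (quadY B) z = 4 * wedgeDet A B z := by
  simp only [pbr, gradient_quadY hA, gradient_quadY hB, wedgeDet_eq, det3]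
  simp only [Matrix.mulVec, dotProduct, Fin.sum_univ_three]
  ring

/-! ## Radial regularity of the coordinates of an admissible family at `r > 0` -/

/-- the derivative of an entry of an admissible family is differentiable at every `r > 0` (entries are `q(r²)` there, `q` smooth). -/
theorem differentiableAt_deriv_entry {Q : ℝ → Matrix (Fin 3) (Fin 3) ℝ} (hQ : IsoAdmissible Q) {r : ℝ} (hr : 0 < r) (i j : Fin 3) :
    DifferentiableAt ℝ (deriv fun s => Q s i j) r := by
  obtain ⟨_, ⟨q, hq, hQq⟩, _⟩ := hQ
  have hg : ContDiff ℝ (⊤ : ℕ∞) (fun s : ℝ => q (s ^ 2) i j) := (hq i j).comp (contDiff_id.pow 2)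
  have hev : (fun s => Q s i j) =ᶠ[𝓝 r] fun s => q (s ^ 2) i j := by
    filter_upwards [Ioi_mem_nhds hr] with s hs
    simp only [hQq s hs.le]
  have h2 : ContDiff ℝ 2 (fun s : ℝ => q (s ^ 2) i j) := hg.of_le (by norm_cast)
  exact (h2.differentiable_deriv_two.differentiableAt).congr_of_eventuallyEq hev.deriv

/-- THE RADIAL DERIVATIVE OF THE WEDGE: for an admissible family and `r > 0`,
`d/ds det[y, Q(s)y, Q′(s)y] |_{s=r} = det[y, Q(r)y, Q″(r)y]` with `Q″(r) = Σₘ cₘ″(r)·Eₘ` in coordinates (the term `det[y, Q′y, Q′y]` vanishes). -/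
theorem hasDerivAt_wedge {Q : ℝ → Matrix (Fin 3) (Fin 3) ℝ} (hQ : IsoAdmissible Q) {r : ℝ} (hr : 0 < r) (y : E3) :
    HasDerivAt (fun s => wedgeDet (Q s) (radDeriv Q s) y)
      (wedgeDet (Q r) (∑ m : Fin 5, deriv (deriv fun s => coordV2 (Q s) m) r • basisV2 m) y) r := by
  -- abbreviations for the coordinate profiles and the constant wedges of the basis
  set c : Fin 5 → ℝ → ℝ := fun m s => coordV2 (Q s) m with hc
  set ω : Fin 5 → Fin 5 → ℝ := fun m m' => wedgeDet (basisV2 m) (basisV2 m') y with hω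
  have hcd : ∀ m, DifferentiableAt ℝ (c m) r := fun m => differentiableAt_entry hQ hr _ _
  have hdd : ∀ m, DifferentiableAt ℝ (deriv (c m)) r := fun m => differentiableAt_deriv_entry hQ hr _ _
  -- near `r` the wedge is the explicit double sum
  have hev : (fun s => wedgeDet (Q s) (radDeriv Q s) y) =ᶠ[𝓝 r]
      fun s => ∑ m : Fin 5, ∑ m' : Fin 5, c m s * deriv (c m') s * ω m m' := by
    filter_upwards [Ioi_mem_nhds hr] with s hs
    rw [radDeriv_eq_sum hQ hs]
    conv_lhs => rw [eq_sum_coordV2 (hQ.1 s hs.le)]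
    rw [wedgeDet_sum_smul_sum_smul]
  -- differentiate the double sum term by term
  have hsum : HasDerivAt (fun s => ∑ m : Fin 5, ∑ m' : Fin 5, c m s * deriv (c m') s * ω m m')
      (∑ m : Fin 5, ∑ m' : Fin 5, (deriv (c m) r * deriv (c m') r + c m r * deriv (deriv (c m')) r) * ω m m') r := by
    refine HasDerivAt.fun_sum fun m _ => HasDerivAt.fun_sum fun m' _ => ?_
    exact ((hcd m).hasDerivAt.mul (hdd m').hasDerivAt).mul_const _
  -- the value: the symmetric part dies, the rest is `det[y, Qy, Q″y]`
  have hval : ∑ m : Fin 5, ∑ m' : Fin 5, (deriv (c m) r * deriv (c m') r + c m r * deriv (deriv (c m')) r) * ω m m' =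
      wedgeDet (Q r) (∑ m : Fin 5, deriv (deriv (c m)) r • basisV2 m) y := by
    have hsplit : ∑ m : Fin 5, ∑ m' : Fin 5, (deriv (c m) r * deriv (c m') r + c m r * deriv (deriv (c m')) r) * ω m m' =
        (∑ m : Fin 5, ∑ m' : Fin 5, deriv (c m) r * deriv (c m') r * ω m m') +
          ∑ m : Fin 5, ∑ m' : Fin 5, c m r * deriv (deriv (c m')) r * ω m m' := by
      rw [← Finset.sum_add_distrib]
      refine Finset.sum_congr rfl fun m _ => ?_
      rw [← Finset.sum_add_distrib]
      refine Finset.sum_congr rfl fun m' _ => ?_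
      ring
    rw [hsplit, ← wedgeDet_sum_smul_sum_smul, wedgeDet_self, zero_add, ← wedgeDet_sum_smul_sum_smul,
      ← eq_sum_coordV2 (hQ.1 r hr.le)]
  rw [← hval]
  exact hsum.congr_of_eventuallyEq hev

/-! ## The two by-name closures -/

/-- ★★ **BRIDGE DP2 OF THE PRESSURE HORN LINE IS A THEOREM** («ORDER ONE IS THE WRONSKIAN»): for the classical solution on `[t₀,T)` issuing from an
admissible `l = 2`-isotypic datum `isoShell Q x₀`, the one-sided first threading jet at `x₀ + r·y` (`|y| = 1`, `r > 0`) equals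
`−24 r⁻³ · d/dr ( r⁶ det[y, Q(r)y, Q′(r)y] )`.  Proof: one-sided jet = formal first jet (M-part, g8); the datum is the degree-two isotypic family of
its coordinate profiles against the basis quadratics (dictionary, p730985); (F1) `fluxJetOne_isoShellL_eq` gives
`6 Σ K₂[c_m] c_{m′} {Y_{E_m}, Y_{E_{m′}}}(r y)`; the wedge calculus turns this into `−24 r³ det[y, Q(r)y, (Q″ + 6Q′/r)(r)y]` and `hasDerivAt_wedge`
identifies it with the right side.  A statement about HYPOTHETICAL isotypic slices (SPECIAL data); ⟨27585⟩, W2 and NS regularity remain OPEN.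
[cite: MajdaBertozziCUP2002, §1.1, §2.1] -/
theorem isotypicOrderOneIdentity_holds : IsotypicOrderOneIdentity := by
  intro t₀ T u p x₀ Q hT hsol hQ hdat r hr y hy
  have hr0 : r ≠ 0 := hr.ne'
  -- the dictionary
  have hadm : IsoAdmissibleL 2 5 (fun m s => coordV2 (Q s) m) (fun m => quadY (basisV2 m)) := isoAdmissibleL_coord hQ
  have hdat' : u t₀ = isoShellL 5 (fun m s => coordV2 (Q s) m) (fun m => quadY (basisV2 m)) x₀ := by
    rw [hdat]
    exact isoShell_eq_isoShellL hQ.1 x₀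
  -- M-part and (F1)
  rw [derivWithin_threadingFlux_Ici_eq_fluxJetOne hsol hT, hdat',
    fluxJetOne_isoShellL_eq (l := 2) (by norm_num) hadm x₀ (r • y)]
  have hnorm : ‖r • y‖ = r := by rw [norm_smul, Real.norm_eq_abs, abs_of_pos hr, hy, mul_one]
  rw [hnorm]
  beta_reduce
  -- brackets → wedges of the basis forms
  have hpbr : ∀ m m' : Fin 5, pbr (quadY (basisV2 m)) (quadY (basisV2 m')) (r • y) =
      4 * (r ^ 3 * wedgeDet (basisV2 m) (basisV2 m') y) := fun m m' => by
    rw [pbr_quadY_quadY (isQuadForm_basisV2 m).1 (isQuadForm_basisV2 m').1, wedgeDet_smul_arg]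
  simp only [hpbr]
  -- the two derived forms `Q′(r)`, `Q″(r)` in coordinates
  obtain ⟨D, hD⟩ : ∃ M : Matrix (Fin 3) (Fin 3) ℝ, M = ∑ m : Fin 5, deriv (fun s => coordV2 (Q s) m) r • basisV2 m := ⟨_, rfl⟩
  obtain ⟨D2, hD2⟩ : ∃ M : Matrix (Fin 3) (Fin 3) ℝ, M = ∑ m : Fin 5, deriv (deriv fun s => coordV2 (Q s) m) r • basisV2 m :=
    ⟨_, rfl⟩
  have hQr : Q r = ∑ m : Fin 5, coordV2 (Q r) m • basisV2 m := eq_sum_coordV2 (hQ.1 r hr.le)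
  have hDr : radDeriv Q r = D := by
    rw [hD]
    exact radDeriv_eq_sum hQ hr
  -- the left side as one wedge: `Σ K c ω = det[y, K y, Q y] = −det[y, Q y, (D2 + (6/r) D) y]`
  have hK : ∑ m : Fin 5, ∑ m' : Fin 5, vortAmpL 2 (fun s => coordV2 (Q s) m) r * coordV2 (Q r) m' *
        (4 * (r ^ 3 * wedgeDet (basisV2 m) (basisV2 m') y)) =
      4 * r ^ 3 * -(wedgeDet (Q r) D2 y + 6 / r * wedgeDet (Q r) D y) := by
    have h1 : ∑ m : Fin 5, ∑ m' : Fin 5, vortAmpL 2 (fun s => coordV2 (Q s) m) r * coordV2 (Q r) m' *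
          (4 * (r ^ 3 * wedgeDet (basisV2 m) (basisV2 m') y)) =
        4 * r ^ 3 * ∑ m : Fin 5, ∑ m' : Fin 5, vortAmpL 2 (fun s => coordV2 (Q s) m) r * coordV2 (Q r) m' *
          wedgeDet (basisV2 m) (basisV2 m') y := by
      rw [Finset.mul_sum]
      refine Finset.sum_congr rfl fun m _ => ?_
      rw [Finset.mul_sum]
      refine Finset.sum_congr rfl fun m' _ => ?_
      ring
    have hv : ∀ m : Fin 5, vortAmpL 2 (fun s => coordV2 (Q s) m) r =
        deriv (deriv fun s => coordV2 (Q s) m) r + 6 / r * deriv (fun s => coordV2 (Q s) m) r := fun m => by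
      simp only [vortAmpL]
      norm_num
    have hKmat : (∑ m : Fin 5, vortAmpL 2 (fun s => coordV2 (Q s) m) r • basisV2 m) = D2 + (6 / r) • D := by
      rw [hD2, hD, Finset.smul_sum, ← Finset.sum_add_distrib]
      refine Finset.sum_congr rfl fun m _ => ?_
      rw [smul_smul, ← add_smul, hv m]
    rw [h1, ← wedgeDet_sum_smul_sum_smul, ← hQr, hKmat, wedgeDet_swap, wedgeDet_add_right, wedgeDet_smul_right]
  rw [hK]
  -- the right side: `d/dr (r⁶ w) = 6 r⁵ w + r⁶ det[y, Qy, D2 y]`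
  have hW : HasDerivAt (fun s => s ^ 6 * wedgeDet (Q s) (radDeriv Q s) y)
      (6 * r ^ 5 * wedgeDet (Q r) (radDeriv Q r) y + r ^ 6 * wedgeDet (Q r) D2 y) r := by
    have h6 : HasDerivAt (fun s : ℝ => s ^ 6) (6 * r ^ 5) r := by
      simpa using hasDerivAt_pow 6 r
    have hw := hasDerivAt_wedge hQ hr y
    rw [← hD2] at hw
    refine (h6.mul hw).congr_deriv ?_
    ring
  rw [hW.deriv, hDr]
  field_simp
  ring

/-- ★★ **RUNG I1 OF THE PRESSURE HORN LINE, UNCONDITIONALLY** («ISOTYPIC ORDER-ONE RIGIDITY»): an admissible `l = 2`-isotypic datum, left-end slice of a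
classical solution whose first one-sided threading jet about `x₀` vanishes, is PIECEWISE SEPARABLE (`det[y, Q(r)y, Q′(r)y] = 0` for all `r > 0`).
DP2 (`isotypicOrderOneIdentity_holds`) + S-E (K2-p2 g13's `eulerVanishing_holds`); the composition `PressureHorn.isotypicOrderOneRigidity_of_identity`
re-proved without the theses-cone import.  SPECIAL data; ⟨27585⟩ / W2 / NS regularity OPEN — no summit statement is proved. -/
theorem isotypicOrderOneRigidity_holds : IsotypicOrderOneRigidity := by
  intro t₀ T u p x₀ Q hT hsol hQa hdat hj1 r hr y hy
  refine eulerVanishing_holds Q y hQa ?_ r hr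
  intro s hs
  have h1 := isotypicOrderOneIdentity_holds t₀ T u p x₀ Q hT hsol hQa hdat s hs y hy
  rw [hj1 (x₀ + s • y)] at h1
  have hc : (-24 : ℝ) * s⁻¹ ^ 3 ≠ 0 := mul_ne_zero (by norm_num) (pow_ne_zero 3 (inv_ne_zero hs.ne'))
  exact (mul_eq_zero.mp h1.symm).resolve_left hc

/-- bookkeeping: **THE SLICE RUNG I2 OF THE PRESSURE HORN LINE WAITS ON THE CRUX X ALONE** — `NestedHornExclusion → IsotypicOrderTwoRigidity`
(I1 = `isotypicOrderOneRigidity_holds` gives the wedge, X makes the datum globally separable, ns-crc-p1 g9's `separableShellOrderTwoRigidity_holds`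
(the `l = 2` separable slice rung, every horn-admissible profile) finishes; K2-p2's `isotypicOrderTwoRigidity_of_horns` with DP2 and the separable rung
struck).  X is OPEN (residual X∞ of infinitely many flat-joined pieces); ⟨27585⟩ / W2 / NS regularity OPEN. -/
theorem isotypicOrderTwoRigidity_of_exclusion (hX : NestedHornExclusion) : IsotypicOrderTwoRigidity := by
  intro t₀ T u p x₀ Q hT hsol hp hQa hdat hj1 hj2
  have hW : WedgeVanishes Q := isotypicOrderOneRigidity_holds t₀ T u p x₀ Q hT hsol hQa hdat hj1
  obtain ⟨H, Q₀, hH, hQ₀, hsep⟩ := hX t₀ T u p x₀ Q hT hsol hp hQa hdat hj1 hj2 hW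
  exact separableShellOrderTwoRigidity_holds t₀ T u p x₀ Q₀ H hT hsol hp hQ₀ hH hsep hj1 hj2

end Summit.NavierStokesRegularity.NavierStokesRegularity.Theorems.UnthreadedRigidity.HornPressure

end
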